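import Literature.NumberTheory.Automorphic.SLTwoTreeUnramifiedEllipticFixedBall     -- ★ (this seat): the VERTEX ball of an unramified-elliptic `g ∈ GL₂(F)` (2u)
import Literature.NumberTheory.Automorphic.SLTwoTreeRamifiedEllipticFixedBall       -- ★ (this seat): the EDGE ball of a ramified-elliptic `g ∈ GL₂(F)` (2r)
import Literature.NumberTheory.Automorphic.UnitaryTwoRamifiedTreeStabilizersPlace   -- ★ F0P3a-p04 (g14) (W2)-Place: `K♯ ↔ ρ_w(u)·v₁ = v₁`; ⊇ ★ (W1c) `rhoVertexActPlace` (B-p08 (g28))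
import Literature.GroupTheory.FixedPointsOrbitMapTransport                         -- ★ B-p14 (g33): `ncard_fixedBy_quotient_eq_of_vertexAction`
import HarnessLib

/-!
# The number of `ϖ`-modular vertices fixed by an ELLIPTIC element of `U(Φ₂)(L_w)` at a TAME-RAMIFIED place, read off its projective descent:
# `(q − 1)·#Fix_u(U_w ⧸ K♯) + 2 = (q + 1)·qⁿ` (unramified-elliptic descent) resp. `= 2·q^{n+1}` (ramified-elliptic descent)
# (Tits 1979 §2.7, §3.9; Labesse–Langlands 1979 §2 p. 8; Kottwitz 1988 §2)

Topic `NumberTheory/Automorphic`; namespace `Literature.NumberTheory.Automorphic.UnitaryGroup`.  THEOREMS ONLY (no definition, no instance, no notation, no named fact,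
no `sorry`); kernel lane `--supports stmt-HodgeConjecture-24833`.  Cell `pub/hodgecm-mathlib` (D-0151), crux H413; «S3-ram» seeding wave (LEAD F0P3a-plan (g12) T11-62;
owner F0P3a-p06 (g15)); seat A-p12 (g23).  Organ «T6-2r ∕ H²-ram», `U_w`-level (one-place model): the `K♯`-column (`χ♯ = 1_{K♯ × K₁}`, the `ϖ`-MODULAR vertex type) of STUB B₂
of the P-2-ram skeleton (α₂) v0.2 (7cc84811) — the stable orbital integral of `χ♯` at a type-(2) `γ_H` unfolds (one class ★ `…_of_not_exists_isRoot`, ★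
`classOrbitalIntegral_indicator_complex_eq_natCard_fixedBy`) to the count of `K♯`-cosets of `U_w = U(σ_w, (Φ₂)_w)(L_w)` fixed by `u = E₂ γ_H.1`, which THIS file expresses
through the projective descent datum `d u d⁻¹ = s·ι(g)` (★ (W1)) and the trace ∕ determinant ∕ discriminant data of `g`.
HONEST LABEL: HC_CM is proved only modulo the cell's 2 remaining named inputs (hLiu418 24832, h413 24833) until rung 0 closes; nothing printed is asserted here — transport
along ★ theorems.

THE MATHEMATICS.  At a tamely ramified `w ∣ v` (`he`), with `α` an ANTI-FIXED UNIFORMISER of `L_w` (`σ_w α = −α`, `|α| = exp(−1)`: the √π-type of ★ (W2)), `U_w` acts on the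
tree of `SL₂(L⁺_v)` by `ρ_w` (★ `rhoVertexActPlace`) TRANSITIVELY on vertices (★ `exists_rhoVertexActPlace_eq'`), and the `ϖ`-modular level `K♯ = U_w ∩ D_η GL₂(𝒪_w) D_η⁻¹` IS the
stabiliser of `v₁ = latt diag(1, ϖ_F)` (★ (W2)-Place `forall_coe_mem_map_conj_glDiagonal_iff_rhoVertexActPlace_next_eq`).  Hence (★ B-p14 `ncard_fixedBy_quotient_eq_of_vertexAction`)
`#Fix_u(U_w ⧸ K♯) = #{x | ρ_w(u)·x = x} = #{x | g·x = x}` for ANY descent representative `g` (★ `rhoVertexActPlace_eq_glVertexAct`), and the two ★ ball theorems of this seat give: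
* **2u** (`tr² g − 4 det g = ε₀ z²`, `ε₀` a non-square unit, `|z∕t| = |ϖ_F|ⁿ`): `(q − 1)·#Fix_u(U_w ⧸ K♯) + 2 = (q + 1)·qⁿ`;
* **2r** (`tr² g − 4 det g = π₁ z²`, `|π₁| = |ϖ_F|`, `|z∕t| = |ϖ_F|ⁿ`): `(q − 1)·#Fix_u(U_w ⧸ K♯) + 2 = 2·q^{n+1}`.
(`q = #𝓀_v`; the parity dictionary `N = 2n` ∕ `2n + 1` with `|tr² − 4det|_w(E₂γ_H.1) = exp(−2N)` is the «TYPE-(2) DESCENT PARITY» organ, F0P3a-p01 (g16) ∕ this seat.)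

* §1 `setOf_rhoVertexActPlace_eq_self_eq` (`{x | ρ_w(u)·x = x} = {x | g·x = x}`), `ncard_fixedBy_quotient_comap_modular_eq_ncard_setOf_glVertexAct` (the `K♯`-coset count as a
  tree count, any `u`).
* §2 HEADS `ncard_fixedBy_quotient_comap_modular_of_unramified_elliptic`, `ncard_fixedBy_quotient_comap_modular_of_ramified_elliptic`.

## References
* [Tits1979] J. Tits, *Reductive groups over local fields*, PSPM 33.1 (1979), §2.7, §3.9 (ramified quasi-split `U(1,1)`: the building is the tree of `SL₂`).
* [LabesseLanglands1979] J.-P. Labesse, R. P. Langlands, *L-indistinguishability for SL(2)*, Canad. J. Math. 31 (1979), §2 p. 8.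
* [Kottwitz1988] R. E. Kottwitz, *Tamagawa numbers*, Ann. of Math. 127 (1988), §2.
* [Serre1980Trees] J.-P. Serre, *Trees* (1980), Ch. I §6.1 (orbit–stabiliser), Ch. II §1.1–§1.3.
-/

set_option autoImplicit false

noncomputable section

open scoped WithZero ValuativeRel Matrix MatrixGroups
open Matrix WithZero ValuativeRel NumberField IsDedekindDomain MulAction

namespace Literature.NumberTheory.Automorphic.UnitaryGroup

open Literature.NumberTheory.Automorphic Literature.NumberTheory.Automorphic.HermitianLatticeTree Literature.GroupTheory

section Place

variable (L : Type) [Field L] [NumberField L] [IsCMField L] (v : HeightOneSpectrum (𝓞 ↥(maximalRealSubfield L)))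
  (w : PlacesOver L v) (hw : IsCMField.complexConj L • w.1 = w.1)
  {α : w.1.adicCompletion L} (hα : galAdicCompletionMap (L := L) (IsCMField.complexConj L) hw α = -α) (hα0 : α ≠ 0)
  {ϖF : v.adicCompletion ↥(maximalRealSubfield L)} (hϖF : Valued.v ϖF = exp (-1 : ℤ))

/-! ## §1 The `K♯`-coset count as a tree count -/

/-- **`{x | ρ_w(u)·x = x} = {x | g·x = x}`** for ANY descent representative `(s, g)` of `u` (★ `rhoVertexActPlace_eq_glVertexAct`, pointwise). [cite: Serre1980Trees, Ch. II §1.3] -/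
theorem setOf_rhoVertexActPlace_eq_self_eq [IsDiscreteValuationRing 𝒪[v.adicCompletion ↥(maximalRealSubfield L)]]
    (u : ↥(unitaryGroupOfForm (galAdicCompletionMap (L := L) (IsCMField.complexConj L) hw)
      (placeForm (Matrix.of fun i j : Fin 2 => if i.val + j.val + 1 = 2 then (1 : L) else 0) w.1)))
    {s : w.1.adicCompletion L} {g : GL (Fin 2) (v.adicCompletion ↥(maximalRealSubfield L))} (hs : s ≠ 0)
    (hsg : Matrix.diagonal ![1, α] * ((u : GL (Fin 2) (w.1.adicCompletion L)) : Matrix (Fin 2) (Fin 2) (w.1.adicCompletion L)) * Matrix.diagonal ![1, α⁻¹] =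
      s • (g : Matrix (Fin 2) (Fin 2) (v.adicCompletion ↥(maximalRealSubfield L))).map (toPlace v w)) :
    {x : {M : Submodule 𝒪[v.adicCompletion ↥(maximalRealSubfield L)] (Fin 2 → v.adicCompletion ↥(maximalRealSubfield L)) //
        IsSpecialLattice (RingHom.id _) ϖF !![(0 : v.adicCompletion ↥(maximalRealSubfield L)), 1; -1, 0] M} | rhoVertexActPlace L v w hw hα hα0 hϖF u x = x} =
      {x | glVertexAct (isUniformizingElement_of_v_eq hϖF) g x = x} := by
  ext x
  simp only [Set.mem_setOf_eq]
  rw [rhoVertexActPlace_eq_glVertexAct L v w hw hα hα0 hϖF u hs hsg x]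

include hα hα0 in
/-- **THE `K♯`-COSET COUNT IS A TREE COUNT** at a tame-ramified place with `α` an anti-fixed uniformiser (√π-type) and `η` any uniformiser of `L_w`: for EVERY `u ∈ U_w` and
any descent representative `(s, g)`, `#Fix_u(U_w ⧸ K♯_η) = #{x | g·x = x}` (`Set.ncard`; `K♯_η = U_w ∩ D_η GL₂(𝒪_w) D_η⁻¹` pulled back along the inclusion) — vertex-transitivity
★ `exists_rhoVertexActPlace_eq'`, stabiliser ★ (W2)-Place, transport ★ B-p14. [cite: Serre1980Trees, Ch. I §6.1; Ch. II §1.3] [cite: Tits1979, §3.9] [cite: Kottwitz1988, §2] -/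
theorem ncard_fixedBy_quotient_comap_modular_eq_ncard_setOf_glVertexAct (he : v.asIdeal.ramificationIdx' w.1.asIdeal ≠ 1)
    (hvα : Valued.v α = exp (-1 : ℤ)) (η : (w.1.adicCompletion L)ˣ) (hη : Valued.v (η : w.1.adicCompletion L) = exp (-1 : ℤ))
    (u : ↥(unitaryGroupOfForm (galAdicCompletionMap (L := L) (IsCMField.complexConj L) hw)
      (placeForm (Matrix.of fun i j : Fin 2 => if i.val + j.val + 1 = 2 then (1 : L) else 0) w.1)))
    {s : w.1.adicCompletion L} {g : GL (Fin 2) (v.adicCompletion ↥(maximalRealSubfield L))} (hs : s ≠ 0)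
    (hsg : Matrix.diagonal ![1, α] * ((u : GL (Fin 2) (w.1.adicCompletion L)) : Matrix (Fin 2) (Fin 2) (w.1.adicCompletion L)) * Matrix.diagonal ![1, α⁻¹] =
      s • (g : Matrix (Fin 2) (Fin 2) (v.adicCompletion ↥(maximalRealSubfield L))).map (toPlace v w)) :
    (fixedBy (↥(unitaryGroupOfForm (galAdicCompletionMap (L := L) (IsCMField.complexConj L) hw)
        (placeForm (Matrix.of fun i j : Fin 2 => if i.val + j.val + 1 = 2 then (1 : L) else 0) w.1)) ⧸
        (((glInt 2 (w.1.adicCompletion L)).map (MulAut.conj (glDiagonal 2 (w.1.adicCompletion L) ![1, η])).toMonoidHom).comap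
          (unitaryGroupOfForm (galAdicCompletionMap (L := L) (IsCMField.complexConj L) hw)
            (placeForm (Matrix.of fun i j : Fin 2 => if i.val + j.val + 1 = 2 then (1 : L) else 0) w.1)).subtype)) u).ncard =
      {x : {M : Submodule 𝒪[v.adicCompletion ↥(maximalRealSubfield L)] (Fin 2 → v.adicCompletion ↥(maximalRealSubfield L)) //
        IsSpecialLattice (RingHom.id _) ϖF !![(0 : v.adicCompletion ↥(maximalRealSubfield L)), 1; -1, 0] M} |
          glVertexAct (isUniformizingElement_of_v_eq hϖF) g x = x}.ncard := by
  haveI : IsDiscreteValuationRing 𝒪[v.adicCompletion ↥(maximalRealSubfield L)] := isDiscreteValuationRing_integer_of_compatible hϖF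
  have h0 : ϖF ≠ 0 := (isUniformizingElement_of_v_eq hϖF).ne_zero
  -- the base vertex `v₁ = latt diag(1, ϖ_F)` (a `ϖ_F`-modular special lattice)
  have hdet1 : (Matrix.diagonal ![(1 : v.adicCompletion ↥(maximalRealSubfield L)), ϖF]).det ≠ 0 := by
    rw [Matrix.det_diagonal, Fin.prod_univ_two]; simpa using h0
  have hmod : IsSpecialLattice (RingHom.id _) ϖF !![(0 : v.adicCompletion ↥(maximalRealSubfield L)), 1; -1, 0]
      (latt (Matrix.diagonal ![(1 : v.adicCompletion ↥(maximalRealSubfield L)), ϖF])) := by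
    refine Or.inr ((isModularLattice_id_altJ_iff h0 _).2 ⟨Matrix.GeneralLinearGroup.mk'' _ (isUnit_iff_ne_zero.2 hdet1), rfl, ?_⟩)
    show valuation _ (Matrix.diagonal ![(1 : v.adicCompletion ↥(maximalRealSubfield L)), ϖF]).det = valuation _ ϖF
    rw [Matrix.det_diagonal, Fin.prod_univ_two]; simp
  set v₁ : {M : Submodule 𝒪[v.adicCompletion ↥(maximalRealSubfield L)] (Fin 2 → v.adicCompletion ↥(maximalRealSubfield L)) //
      IsSpecialLattice (RingHom.id _) ϖF !![(0 : v.adicCompletion ↥(maximalRealSubfield L)), 1; -1, 0] M} := ⟨_, hmod⟩ with hv₁def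
  have hv₁ : v₁.1 = latt (Matrix.diagonal ![(1 : v.adicCompletion ↥(maximalRealSubfield L)), ϖF]) := rfl
  -- stabiliser dictionary and transitivity
  have hKv := forall_coe_mem_map_conj_glDiagonal_iff_rhoVertexActPlace_next_eq L v w hw hα hα0 hϖF v₁ hv₁ he hvα η hη
  have hV : ∀ x, ∃ u' : ↥(unitaryGroupOfForm (galAdicCompletionMap (L := L) (IsCMField.complexConj L) hw)
      (placeForm (Matrix.of fun i j : Fin 2 => if i.val + j.val + 1 = 2 then (1 : L) else 0) w.1)), rhoVertexActPlace L v w hw hα hα0 hϖF u' v₁ = x :=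
    fun x => exists_rhoVertexActPlace_eq' L v w hw hα hα0 hϖF he v₁ x
  rw [ncard_fixedBy_quotient_eq_of_vertexAction (rhoVertexActPlace L v w hw hα hα0 hϖF) (rhoVertexActPlace_one L v w hw hα hα0 hϖF)
    (rhoVertexActPlace_mul L v w hw hα hα0 hϖF) hV _ (fun g' => by rw [Subgroup.mem_comap, Subgroup.coe_subtype]; exact hKv g') u,
    setOf_rhoVertexActPlace_eq_self_eq L v w hw hα hα0 hϖF u hs hsg]

/-! ## §2 The two elliptic counts -/

include hα hα0 hϖF in
/-- **2u — THE MODULAR FIXED-COSET COUNT FOR AN UNRAMIFIED-ELLIPTIC DESCENT**: at a tame-ramified place (`α` anti-fixed uniformiser, `η` any uniformiser), if the descent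
representative `g` of `u ∈ U_w` has `tr g = t ≠ 0`, `det g = d`, `t² − 4d = ε₀·z²` (`ε₀` a unit of non-square residue, `z ≠ 0`, `2 ≠ 0`) and `|z·t⁻¹| = |ϖ_F|ⁿ`, then
**`(q − 1)·#Fix_u(U_w ⧸ K♯_η) + 2 = (q + 1)·qⁿ`** — the vertex ball of radius `n` (★ `ncard_setOf_glVertexAct_eq_self_of_unramified_elliptic`).  In the type-(2) application
`n = N∕2` for the EVEN discriminant depth `2N` of `γ_H.1` at `w`. [cite: LabesseLanglands1979, §2 p. 8] [cite: Kottwitz1988, §2] [cite: Tits1979, §3.9] -/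
theorem ncard_fixedBy_quotient_comap_modular_of_unramified_elliptic [Finite (IsLocalRing.ResidueField 𝒪[v.adicCompletion ↥(maximalRealSubfield L)])]
    (he : v.asIdeal.ramificationIdx' w.1.asIdeal ≠ 1)
    (hvα : Valued.v α = exp (-1 : ℤ)) (η : (w.1.adicCompletion L)ˣ) (hη : Valued.v (η : w.1.adicCompletion L) = exp (-1 : ℤ))
    (u : ↥(unitaryGroupOfForm (galAdicCompletionMap (L := L) (IsCMField.complexConj L) hw)
      (placeForm (Matrix.of fun i j : Fin 2 => if i.val + j.val + 1 = 2 then (1 : L) else 0) w.1)))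
    {s : w.1.adicCompletion L} {g : GL (Fin 2) (v.adicCompletion ↥(maximalRealSubfield L))} (hs : s ≠ 0)
    (hsg : Matrix.diagonal ![1, α] * ((u : GL (Fin 2) (w.1.adicCompletion L)) : Matrix (Fin 2) (Fin 2) (w.1.adicCompletion L)) * Matrix.diagonal ![1, α⁻¹] =
      s • (g : Matrix (Fin 2) (Fin 2) (v.adicCompletion ↥(maximalRealSubfield L))).map (toPlace v w))
    (h2 : (2 : v.adicCompletion ↥(maximalRealSubfield L)) ≠ 0)
    {ε₀ : v.adicCompletion ↥(maximalRealSubfield L)} (hε₀ : ε₀ ∈ 𝒪[v.adicCompletion ↥(maximalRealSubfield L)])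
    (hns : ∀ b : v.adicCompletion ↥(maximalRealSubfield L), b ∈ 𝒪[v.adicCompletion ↥(maximalRealSubfield L)] → valuation _ (b ^ 2 - ε₀) = 1)
    {t d z : v.adicCompletion ↥(maximalRealSubfield L)}
    (htr : (g : Matrix (Fin 2) (Fin 2) (v.adicCompletion ↥(maximalRealSubfield L))).trace = t) (hdet : (g : Matrix (Fin 2) (Fin 2) (v.adicCompletion ↥(maximalRealSubfield L))).det = d)
    (ht : t ≠ 0) (hz : z ≠ 0) (hD : t ^ 2 - 4 * d = ε₀ * z ^ 2) {n : ℕ}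
    (hn : valuation (v.adicCompletion ↥(maximalRealSubfield L)) (z * t⁻¹) = valuation (v.adicCompletion ↥(maximalRealSubfield L)) ϖF ^ n) :
    (Nat.card (IsLocalRing.ResidueField 𝒪[v.adicCompletion ↥(maximalRealSubfield L)]) - 1) *
        (fixedBy (↥(unitaryGroupOfForm (galAdicCompletionMap (L := L) (IsCMField.complexConj L) hw)
          (placeForm (Matrix.of fun i j : Fin 2 => if i.val + j.val + 1 = 2 then (1 : L) else 0) w.1)) ⧸
          (((glInt 2 (w.1.adicCompletion L)).map (MulAut.conj (glDiagonal 2 (w.1.adicCompletion L) ![1, η])).toMonoidHom).comap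
            (unitaryGroupOfForm (galAdicCompletionMap (L := L) (IsCMField.complexConj L) hw)
              (placeForm (Matrix.of fun i j : Fin 2 => if i.val + j.val + 1 = 2 then (1 : L) else 0) w.1)).subtype)) u).ncard + 2 =
      (Nat.card (IsLocalRing.ResidueField 𝒪[v.adicCompletion ↥(maximalRealSubfield L)]) + 1) * Nat.card (IsLocalRing.ResidueField 𝒪[v.adicCompletion ↥(maximalRealSubfield L)]) ^ n := by
  haveI : IsDiscreteValuationRing 𝒪[v.adicCompletion ↥(maximalRealSubfield L)] := isDiscreteValuationRing_integer_of_compatible hϖF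
  -- the root `v₀ = latt 1`
  have hsd : IsSpecialLattice (RingHom.id _) ϖF !![(0 : v.adicCompletion ↥(maximalRealSubfield L)), 1; -1, 0]
      (latt (1 : Matrix (Fin 2) (Fin 2) (v.adicCompletion ↥(maximalRealSubfield L)))) :=
    Or.inl ((isSelfDualLattice_id_altJ_iff _).2 ⟨1, by rw [Units.val_one], by rw [Units.val_one, det_one, map_one]⟩)
  rw [ncard_fixedBy_quotient_comap_modular_eq_ncard_setOf_glVertexAct L v w hw hα hα0 hϖF he hvα η hη u hs hsg]
  exact ncard_setOf_glVertexAct_eq_self_of_unramified_elliptic (isUniformizingElement_of_v_eq hϖF) h2 hε₀ hns htr hdet ht hz hD hn ⟨_, hsd⟩ rfl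

include hα hα0 hϖF in
/-- **2r — THE MODULAR FIXED-COSET COUNT FOR A RAMIFIED-ELLIPTIC DESCENT**: same setting with `t² − 4d = π₁·z²`, `|π₁| = |ϖ_F|`:
**`(q − 1)·#Fix_u(U_w ⧸ K♯_η) + 2 = 2·q^{n+1}`** — the edge ball of radius `n` (★ `ncard_setOf_glVertexAct_eq_self_of_ramified_elliptic`).  In the type-(2) application
`n = (N − 1)∕2` for the ODD discriminant depth. [cite: LabesseLanglands1979, §2 p. 8] [cite: Kottwitz1988, §2] [cite: Tits1979, §3.9] -/
theorem ncard_fixedBy_quotient_comap_modular_of_ramified_elliptic [Finite (IsLocalRing.ResidueField 𝒪[v.adicCompletion ↥(maximalRealSubfield L)])]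
    (he : v.asIdeal.ramificationIdx' w.1.asIdeal ≠ 1)
    (hvα : Valued.v α = exp (-1 : ℤ)) (η : (w.1.adicCompletion L)ˣ) (hη : Valued.v (η : w.1.adicCompletion L) = exp (-1 : ℤ))
    (u : ↥(unitaryGroupOfForm (galAdicCompletionMap (L := L) (IsCMField.complexConj L) hw)
      (placeForm (Matrix.of fun i j : Fin 2 => if i.val + j.val + 1 = 2 then (1 : L) else 0) w.1)))
    {s : w.1.adicCompletion L} {g : GL (Fin 2) (v.adicCompletion ↥(maximalRealSubfield L))} (hs : s ≠ 0)
    (hsg : Matrix.diagonal ![1, α] * ((u : GL (Fin 2) (w.1.adicCompletion L)) : Matrix (Fin 2) (Fin 2) (w.1.adicCompletion L)) * Matrix.diagonal ![1, α⁻¹] =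
      s • (g : Matrix (Fin 2) (Fin 2) (v.adicCompletion ↥(maximalRealSubfield L))).map (toPlace v w))
    (h2 : (2 : v.adicCompletion ↥(maximalRealSubfield L)) ≠ 0)
    {π₁ : v.adicCompletion ↥(maximalRealSubfield L)} (hπ₁ : valuation (v.adicCompletion ↥(maximalRealSubfield L)) π₁ = valuation _ ϖF)
    {t d z : v.adicCompletion ↥(maximalRealSubfield L)}
    (htr : (g : Matrix (Fin 2) (Fin 2) (v.adicCompletion ↥(maximalRealSubfield L))).trace = t) (hdet : (g : Matrix (Fin 2) (Fin 2) (v.adicCompletion ↥(maximalRealSubfield L))).det = d)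
    (ht : t ≠ 0) (hz : z ≠ 0) (hD : t ^ 2 - 4 * d = π₁ * z ^ 2) {n : ℕ}
    (hn : valuation (v.adicCompletion ↥(maximalRealSubfield L)) (z * t⁻¹) = valuation (v.adicCompletion ↥(maximalRealSubfield L)) ϖF ^ n) :
    (Nat.card (IsLocalRing.ResidueField 𝒪[v.adicCompletion ↥(maximalRealSubfield L)]) - 1) *
        (fixedBy (↥(unitaryGroupOfForm (galAdicCompletionMap (L := L) (IsCMField.complexConj L) hw)
          (placeForm (Matrix.of fun i j : Fin 2 => if i.val + j.val + 1 = 2 then (1 : L) else 0) w.1)) ⧸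
          (((glInt 2 (w.1.adicCompletion L)).map (MulAut.conj (glDiagonal 2 (w.1.adicCompletion L) ![1, η])).toMonoidHom).comap
            (unitaryGroupOfForm (galAdicCompletionMap (L := L) (IsCMField.complexConj L) hw)
              (placeForm (Matrix.of fun i j : Fin 2 => if i.val + j.val + 1 = 2 then (1 : L) else 0) w.1)).subtype)) u).ncard + 2 =
      2 * Nat.card (IsLocalRing.ResidueField 𝒪[v.adicCompletion ↥(maximalRealSubfield L)]) ^ (n + 1) := by
  haveI : IsDiscreteValuationRing 𝒪[v.adicCompletion ↥(maximalRealSubfield L)] := isDiscreteValuationRing_integer_of_compatible hϖF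
  have hsd : IsSpecialLattice (RingHom.id _) ϖF !![(0 : v.adicCompletion ↥(maximalRealSubfield L)), 1; -1, 0]
      (latt (1 : Matrix (Fin 2) (Fin 2) (v.adicCompletion ↥(maximalRealSubfield L)))) :=
    Or.inl ((isSelfDualLattice_id_altJ_iff _).2 ⟨1, by rw [Units.val_one], by rw [Units.val_one, det_one, map_one]⟩)
  rw [ncard_fixedBy_quotient_comap_modular_eq_ncard_setOf_glVertexAct L v w hw hα hα0 hϖF he hvα η hη u hs hsg]
  exact ncard_setOf_glVertexAct_eq_self_of_ramified_elliptic (isUniformizingElement_of_v_eq hϖF) h2 hπ₁ htr hdet ht hz hD hn ⟨_, hsd⟩ rfl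

end Place

end Literature.NumberTheory.Automorphic.UnitaryGroup

end
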